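import Summits.BirchSwinnertonDyer.BirchSwinnertonDyer.Theorems.AlignedTransportAtTwoMainConjectureOfRankZeroBSDAtTwoCubicRankDoorModels
import Summits.BirchSwinnertonDyer.BirchSwinnertonDyer.Theorems.AlignedTransportAtTwoMainConjectureOfRankZeroBSDAtTwoCubicKilfordPrimes
import HarnessLib

/-!
# Route `AlignedTransportAtTwo`, crux C2 `MainConjectureOfRankZeroBSDAtTwo` (stmt-22298), line `birth` — THE RUNG-`0` RANK DOOR ON CONCRETE MODELS,
# KILFORD STRATUM: `rank₂ Cl(ℚ(β, √2)) = rank₂ Cl(ℚ(β))` ⟹ `MC₂(W)` — the cheapest certificate of the cubic road (class groups of ONE cubic and ONE sextic field)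

HONEST FRAMING (cell `bsd-f1-sign2`, WIDTH-5 attach seat `bsd-line-att-p4` g25; `--supports stmt-BirchSwinnertonDyer-22298 --as helper`).
THEOREMS ONLY (no `def`, no named fact, no `sorry`). BSD is NOT proved; C2 is NOT closed; its verdict «blocked-on
`Rank1Residual.GreenbergMuConjectureIrreducible`» is untouched; everything is CONDITIONAL on the displayed PRINT named facts, the registered stub MuIneqʳ
(verbatim) and the displayed per-curve certificate. No new mathematics: att-p5 g25/g26's index-`0` rank door on the Kilford stratum
(`…CubicKilfordPrimes.mazurMainConjecture_two_of_muIneqRel_of_minimalDiscriminantInt_emod_eight_of_classGroupPRank_succ_eq`: three primes above `2` in `ℚ(β)`,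
each totally ramified from layer `0`) read on the layer MODELS of g25's `…CubicRankDoorModels` at the rung `m = 0`: the layer-`0` model is `ℚ(β)` itself, the
layer-`1` model any quadratic extension `L' ⊇ ℚ(β)` with a square root of `2`.

* §1 `forall_classGroupPRank_one_eq_zero_of_layerOne_model` — cubic `K`, `L' ⊇ K` of degree `2` with `θ² = 2`, `rank₂ Cl(L') = rank₂ Cl(K)` ⟹
  `classGroupPRank κ 1 = classGroupPRank κ 0` for every cyclotomic `κ` (g25 `forall_classGroupPRank_succ_eq_of_layer_models` at `m = 0`, `L = K`, `θ = 0`).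
* §2 **THE RUNG-`0` MODELS DOOR** `mazurMainConjecture_two_of_muIneqRel_of_classGroup_layerZeroOne_models` (`Δ_W < 0`, `Δ_min ≡ 1 (mod 8)`): PRINT⁵ + MuIneqʳ + cell
  hypotheses + `β` + `L' ⊇ ℚ(β)`, `[L' : ℚ(β)] = 2`, `θ² = 2` in `L'`, **`rank₂ Cl(L') = rank₂ Cl(ℚ(β))`** ⟹ `MC₂(W)`; `hμan`-free.
* §3 ROW `1727a1` at the rung `0`: displayed {`r_an = 0`, `rank₂ Cl(ℚ(β, √2)) = rank₂ Cl(ℚ(β))`} + PRINT⁵ + Creutz–Miller + MuIneqʳ ⟹ `MC₂(1727a1)` — DATA ASK (-data):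
  is `rank₂ Cl(ℚ(β)(√2)) = rank₂ Cl(ℚ(β))` for the cubic field of `1727a1` (`4x³ − 3x² − 304x + 1100`)? (the layer-(1,2) equality `2 = 2` is of record, bsd-2adic
  kit j300990; the layer-`0` rank is not in the cell's tables). The same row shape serves every Kilford seed (`Δ_min ≡ 1 (mod 8)`: all twelve certified seeds).

Off the stratum (`Δ_min ≢ 1 (mod 8)`) the rung `0` needs Fukuda index `0`, i.e. att-p5 g28's ramification lemma (in flight); the rungs `m ≥ 1` of
`…CubicRankDoorModels` need nothing. PARTITION (D-0171): none moved. Beyond-print theorem: no. BSD is NOT proved.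

References: [Fukuda1994] Thm. 1 (2), p. 264; [Washington1997] §13.1, Lemma 13.3; [NeukirchANT1999] Ch. II §8; [Serre1973] Ch. II §3.3 Thm. 4;
[Kato2004Asterisque] Thm. 17.4 (1)(2); [GreenbergLNM1716] Thm. 4.1, Conj. 1.11; [CreutzMiller2012] Thm. 1.1; [CremonaAlgorithms1997] Table 1 (`1727a1`).
-/

set_option linter.dupNamespace false
set_option autoImplicit false

noncomputable section

open scoped MatrixGroups ModularForm NumberField Classical
open CongruenceSubgroup WeierstrassCurve Polynomial NumberField Module Field
open Literature.NumberTheory.EllipticCurves Literature.NumberTheory.EllipticCurves.ModularForms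
open Literature.NumberTheory.EllipticCurves.Greenberg1999 Literature.NumberTheory.EllipticCurves.Module
open Literature.NumberTheory.EllipticCurves.Rank1Residual Literature.NumberTheory.EllipticCurves.Rank1Residual.Typed
open Literature.NumberTheory.GaloisRepresentations Literature.NumberTheory.IwasawaTheory
open Summit.BirchSwinnertonDyer.Rank1Residual Summit.BirchSwinnertonDyer.Rank1Residual.F1Sign2
open Summit.BirchSwinnertonDyer.Rank1Residual.X1.MuLambda Summit.BirchSwinnertonDyer.Rank1Residual.X5
open Summit.BirchSwinnertonDyer.BirchSwinnertonDyer.Theorems.Rank1ResidualX1Defs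
open Summit.BirchSwinnertonDyer.BirchSwinnertonDyer.Theses.AlignedTransportAtTwo
open Summit.BirchSwinnertonDyer.BirchSwinnertonDyer.Theorems.AlignedTransportAtTwoCubicKilfordPrimes
  (mazurMainConjecture_two_of_muIneqRel_of_minimalDiscriminantInt_emod_eight_of_classGroupPRank_succ_eq)
open Summit.BirchSwinnertonDyer.BirchSwinnertonDyer.Theorems.AlignedTransportAtTwoCubicNarrowRankDoor
  (finrank_adjoin_eq_three_of_forall_not_hasRationalTwoTorsionX)
open Summit.BirchSwinnertonDyer.BirchSwinnertonDyer.Theorems.AlignedTransportAtTwoCubicRankDoorModels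
  (forall_classGroupPRank_succ_eq_of_layer_models)
open Summit.BirchSwinnertonDyer.BirchSwinnertonDyer.Theorems.TowerClass
open Summit.BirchSwinnertonDyer.BirchSwinnertonDyer.Theorems.AlignedTransportAtTwoTwistFamilySmallSeeds
open Summit.BirchSwinnertonDyer.BirchSwinnertonDyer.Theorems (AnalyticMuTwo.red_ne_zero_of_isEvenBranchLiftAtTwo_of_forall_not_hasRationalTwoTorsionX)

namespace Summit.BirchSwinnertonDyer.BirchSwinnertonDyer.Theorems.AlignedTransportAtTwoCubicRankDoorModelsRungZero

/-! ## §1 The rung `0` on models: layer `0` is the field itself -/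

/-- **The rung `(0, 1)` on models** (cubic `K`): a quadratic extension `L' ⊇ K` containing `θ` with `θ² = 2` and `rank₂ Cl(L') = rank₂ Cl(K)` give
`classGroupPRank κ 1 = classGroupPRank κ 0` for EVERY cyclotomic `ℤ₂`-extension `κ` of `K` (layer-`0` model `K` itself with `θ₀ = 0`, layer-`1` model `L'`).
[cite: Washington1997, §13.1 (`K_0 = K`, `K_1 = K(√2)` for `[K:ℚ]` odd)] [cite: Fukuda1994, Thm. 1 (2), p. 264] -/
theorem forall_classGroupPRank_one_eq_zero_of_layerOne_model {K : Type} [Field K] [NumberField K] (h3 : Module.finrank ℚ K = 3)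
    (L' : Type*) [Field L'] [NumberField L'] [Algebra K L'] (hL' : Module.finrank K L' = 2) (θ : L') (hθ : θ ^ 2 = 2)
    (hr : padicValNat 2 (Nat.card (ClassGroup (𝓞 L') ⧸ (powMonoidHom 2 : ClassGroup (𝓞 L') →* ClassGroup (𝓞 L')).range)) =
      padicValNat 2 (Nat.card (ClassGroup (𝓞 K) ⧸ (powMonoidHom 2 : ClassGroup (𝓞 K) →* ClassGroup (𝓞 K)).range))) :
    ∀ κ : ZpExtension K 2, κ.IsCyclotomic → classGroupPRank κ 1 = classGroupPRank κ 0 :=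
  forall_classGroupPRank_succ_eq_of_layer_models h3 0 K (by rw [Module.finrank_self]; rfl) (0 : K)
    (Function.iterate_zero_apply _ _) L' (by rw [hL']; rfl) θ
    (by show θ ^ 2 - 2 = 0; rw [hθ, sub_self]) hr

/-! ## §2 THE RUNG-`0` MODELS DOOR on the Kilford stratum -/

section Door

variable (W : WeierstrassCurve ℚ) [W.IsElliptic] [W.IsGloballyMinimal]

/-- **THE RUNG-`0` MODELS DOOR (Kilford stratum, `Δ_W < 0`).** PRINT⁵ {Kato 17.4 (1)(2) at `2`, Greenberg 4.1, period unit, modularity, GZK} + MuIneqʳ (verbatim) +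
cell hypotheses (good ordinary at `2`, no rational `2`-torsion abscissa, `Δ_W < 0`, `Δ_min ≡ 1 (mod 8)`, `r_an = 0`, `BSD₂(W)`) + `β` a root of the `2`-division cubic +
ANY quadratic extension `L' ⊇ ℚ(β)` with a square root of `2` (a model of the first layer `ℚ(β)(√2)`) with **`rank₂ Cl(L') = rank₂ Cl(ℚ(β))`** ⟹ `MC₂(W)`; `hμan`-free
(tree theorem `AnalyticMuTwo.red_ne_zero_…`). On the stratum the three primes above `2` are totally ramified from layer `0` (att-p5 g25/g26), so Fukuda Thm. 1 (2)
fires at the pair `(0, 1)`. CONDITIONAL; nothing closed; BSD is NOT proved. [cite: Fukuda1994, Thm. 1 (2), p. 264] [cite: Serre1973, Ch. II §3.3 Thm. 4]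
[cite: Kato2004Asterisque, Thm. 17.4 (1)(2) (p. 273)] [cite: GreenbergLNM1716, Thm. 4.1 (p. 102) and Conj. 1.11 (p. 58)] -/
theorem mazurMainConjecture_two_of_muIneqRel_of_classGroup_layerZeroOne_models
    (h17 : ∀ [NeZero (W.conductorNorm ℤ)] (f : CuspForm (Gamma0 (W.conductorNorm ℤ)) 2),
      kato_divisibility_allPrimes W 2 (f := f))
    (hGr : Greenberg1999.thm41_charValue_rankZero_anyPrime)
    (hper : realPeriodRat_eq_unit_mul_plusPeriod_two) (hmod : nonempty_modularParametrizationData)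
    (hGZK : rank_eq_analyticRank_of_analyticRank_le_one)
    (hI : ∀ (W : WeierstrassCurve ℚ) [W.IsElliptic] [W.IsGloballyMinimal], IsOrdinaryAt W 2 →
      (∀ x : ℚ, ¬ HasRationalTwoTorsionX W x) →
      ∀ (κ : ZpExtension ℚ 2) (γ : Field.absoluteGaloisGroup ℚ), κ.IsCyclotomic →
      κ.IsTopGenerator γ → IsCyclotomicVariable 2 γ →
      ∀ ⦃N : ℕ⦄ [NeZero N] (f : CuspForm (Gamma0 N) 2), IsNewformOf W f →
      ∀ Gp : IwasawaAlgebra 2, iwasawaToPowerSeries 2 Gp = padicLFunction f (unitRoot W 2 : ℚ_[2]) →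
      ∀ (D : W.SelmerDualData κ γ) (Yr : W.FineSelmerDualDataRelaxedInf κ γ),
        lengthAt (IwasawaAlgebra 2) D.X ⟨IwasawaAlgebra.augIdealP 2, IwasawaAlgebra.isPrime_augIdealP_holds 2⟩ ≤
          lengthAt (IwasawaAlgebra 2) (IwasawaAlgebra 2 ⧸ Ideal.span {Gp})
              ⟨IwasawaAlgebra.augIdealP 2, IwasawaAlgebra.isPrime_augIdealP_holds 2⟩ +
            lengthAt (IwasawaAlgebra 2) Yr.X ⟨IwasawaAlgebra.augIdealP 2, IwasawaAlgebra.isPrime_augIdealP_holds 2⟩)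
    (hord : IsOrdinaryAt W 2) (ht : ∀ x : ℚ, ¬ HasRationalTwoTorsionX W x) (hΔ : W.Δ < 0) (hr : W.analyticRank = 0) (hbsd : BSDp W 2)
    (h8 : minimalDiscriminantInt W % 8 = 1)
    {β : AlgebraicClosure ℚ} (hβ : aeval β W.twoTorsionPolynomial.toPoly = 0)
    (L' : Type) [Field L'] [NumberField L'] [Algebra ↥(IntermediateField.adjoin ℚ ({β} : Set (AlgebraicClosure ℚ))) L']
    (hL' : Module.finrank ↥(IntermediateField.adjoin ℚ ({β} : Set (AlgebraicClosure ℚ))) L' = 2) (θ : L') (hθ : θ ^ 2 = 2)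
    (hrank : padicValNat 2 (Nat.card (ClassGroup (𝓞 L') ⧸ (powMonoidHom 2 : ClassGroup (𝓞 L') →* ClassGroup (𝓞 L')).range)) =
      padicValNat 2 (Nat.card (ClassGroup (𝓞 ↥(IntermediateField.adjoin ℚ ({β} : Set (AlgebraicClosure ℚ)))) ⧸
        (powMonoidHom 2 : ClassGroup (𝓞 ↥(IntermediateField.adjoin ℚ ({β} : Set (AlgebraicClosure ℚ)))) →*
          ClassGroup (𝓞 ↥(IntermediateField.adjoin ℚ ({β} : Set (AlgebraicClosure ℚ))))).range))) :
    MazurMainConjecture W 2 := by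
  haveI : FiniteDimensional ℚ ↥(IntermediateField.adjoin ℚ ({β} : Set (AlgebraicClosure ℚ))) :=
    IntermediateField.adjoin.finiteDimensional ((AlgebraicClosure.isAlgebraic ℚ).isAlgebraic β).isIntegral
  haveI : NumberField ↥(IntermediateField.adjoin ℚ ({β} : Set (AlgebraicClosure ℚ))) := NumberField.mk
  have h3 := finrank_adjoin_eq_three_of_forall_not_hasRationalTwoTorsionX W ht hβ
  exact mazurMainConjecture_two_of_muIneqRel_of_minimalDiscriminantInt_emod_eight_of_classGroupPRank_succ_eq W h17 hGr hper hmod hGZK hI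
    hord ht hΔ hr (AnalyticMuTwo.red_ne_zero_of_isEvenBranchLiftAtTwo_of_forall_not_hasRationalTwoTorsionX W hord ht) hbsd h8 hβ
    fun κP hκP => ⟨0, forall_classGroupPRank_one_eq_zero_of_layerOne_model h3 L' hL' θ hθ hrank κP hκP⟩

end Door

/-! ## §3 Row `1727a1` at the rung `0` -/

/-- `Δ_min(1727a1) ≡ 1 (mod 8)`: `1727a1` is ON the Kilford stratum. [cite: CremonaAlgorithms1997, Table 1] -/
theorem minimalDiscriminantInt_emod_eight_1727a1 : c1727a1.minimalDiscriminantInt % 8 = 1 := by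
  rw [TowerClass.minimalDiscriminantInt_1727a1]; decide

/-- **ROW `1727a1` AT THE RUNG `0`** (the cheapest certificate shape of the cubic road): PRINT⁵ + Creutz–Miller (`N = 1727 < 5000`) + MuIneqʳ + displayed
{`r_an(1727a1) = 0`; a quadratic extension `L' ⊇ ℚ(β)` with `θ² = 2` and **`rank₂ Cl(L') = rank₂ Cl(ℚ(β))`**} ⟹ `MC₂(1727a1)` (`β` any root of
`4x³ − 3x² − 304x + 1100`, the `2`-division cubic of `[1,−1,0,−76,275]`). DATA ASK (-data / -imc): the 2-rank of `Cl(ℚ(β))` vs that of `Cl(ℚ(β, √2))`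
(layers (1,2) of record: `2 = 2`). CONDITIONAL; BSD is NOT proved. [cite: Fukuda1994, Thm. 1 (2), p. 264] [cite: CreutzMiller2012, Thm. 1.1]
[cite: Kato2004Asterisque, Thm. 17.4 (1)(2) (p. 273)] -/
theorem mazurMainConjecture_two_1727a1_of_classGroup_layerZeroOne_models
    (h17 : ∀ [NeZero (c1727a1.conductorNorm ℤ)] (f : CuspForm (Gamma0 (c1727a1.conductorNorm ℤ)) 2),
      kato_divisibility_allPrimes c1727a1 2 (f := f))
    (hGr : Greenberg1999.thm41_charValue_rankZero_anyPrime)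
    (hper : realPeriodRat_eq_unit_mul_plusPeriod_two) (hmod : nonempty_modularParametrizationData)
    (hGZK : rank_eq_analyticRank_of_analyticRank_le_one) (hCM : bsdTriple_of_rank_le_one_of_conductor_lt)
    (hI : ∀ (W : WeierstrassCurve ℚ) [W.IsElliptic] [W.IsGloballyMinimal], IsOrdinaryAt W 2 →
      (∀ x : ℚ, ¬ HasRationalTwoTorsionX W x) →
      ∀ (κ : ZpExtension ℚ 2) (γ : Field.absoluteGaloisGroup ℚ), κ.IsCyclotomic →
      κ.IsTopGenerator γ → IsCyclotomicVariable 2 γ →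
      ∀ ⦃N : ℕ⦄ [NeZero N] (f : CuspForm (Gamma0 N) 2), IsNewformOf W f →
      ∀ Gp : IwasawaAlgebra 2, iwasawaToPowerSeries 2 Gp = padicLFunction f (unitRoot W 2 : ℚ_[2]) →
      ∀ (D : W.SelmerDualData κ γ) (Yr : W.FineSelmerDualDataRelaxedInf κ γ),
        lengthAt (IwasawaAlgebra 2) D.X ⟨IwasawaAlgebra.augIdealP 2, IwasawaAlgebra.isPrime_augIdealP_holds 2⟩ ≤
          lengthAt (IwasawaAlgebra 2) (IwasawaAlgebra 2 ⧸ Ideal.span {Gp})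
              ⟨IwasawaAlgebra.augIdealP 2, IwasawaAlgebra.isPrime_augIdealP_holds 2⟩ +
            lengthAt (IwasawaAlgebra 2) Yr.X ⟨IwasawaAlgebra.augIdealP 2, IwasawaAlgebra.isPrime_augIdealP_holds 2⟩)
    (hr0 : c1727a1.analyticRank = 0)
    {β : AlgebraicClosure ℚ} (hβ : aeval β c1727a1.twoTorsionPolynomial.toPoly = 0)
    (L' : Type) [Field L'] [NumberField L'] [Algebra ↥(IntermediateField.adjoin ℚ ({β} : Set (AlgebraicClosure ℚ))) L']
    (hL' : Module.finrank ↥(IntermediateField.adjoin ℚ ({β} : Set (AlgebraicClosure ℚ))) L' = 2) (θ : L') (hθ : θ ^ 2 = 2)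
    (hrank : padicValNat 2 (Nat.card (ClassGroup (𝓞 L') ⧸ (powMonoidHom 2 : ClassGroup (𝓞 L') →* ClassGroup (𝓞 L')).range)) =
      padicValNat 2 (Nat.card (ClassGroup (𝓞 ↥(IntermediateField.adjoin ℚ ({β} : Set (AlgebraicClosure ℚ)))) ⧸
        (powMonoidHom 2 : ClassGroup (𝓞 ↥(IntermediateField.adjoin ℚ ({β} : Set (AlgebraicClosure ℚ)))) →*
          ClassGroup (𝓞 ↥(IntermediateField.adjoin ℚ ({β} : Set (AlgebraicClosure ℚ))))).range))) :
    MazurMainConjecture c1727a1 2 :=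
  mazurMainConjecture_two_of_muIneqRel_of_classGroup_layerZeroOne_models c1727a1 h17 hGr hper hmod hGZK hI goodOrd_two_1727a1
    not_hasRationalTwoTorsionX_1727a1 Δ_1727a1_neg' hr0 (bsdp_two_1727a1_of_creutzMiller hCM hGZK hr0) minimalDiscriminantInt_emod_eight_1727a1 hβ
    L' hL' θ hθ hrank

end Summit.BirchSwinnertonDyer.BirchSwinnertonDyer.Theorems.AlignedTransportAtTwoCubicRankDoorModelsRungZero

end
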